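import Summits.QuantumFields.QCD.Theses.HeatSlicedQuarks
import Literature.MathematicalPhysics.QuantumLattice.OverlapLocality
import Literature.MathematicalPhysics.QuantumLattice.LatticeToriProofs
import Summits.QuantumFields.QCD.Theorems.ActionBoundsLowModes.Negative.LoadBearing

/-!
# Stub `stub_curvSqLeAction` of line `Sketch` (idea `drop-the-wilson-square`)
(crux `Summit.QuantumFields.QCD.Theses.HeatSlicedQuarks.ActionBoundsLowModes`, item stmt-QuantumFields-8872,
route route-QuantumFields-HeatSlicedQuarks)

The curvature site potential of an `SU(3)` lattice gauge field `U` on the torus `(ℤ/Lℤ)⁴` is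
`V(U,x) = Σ_{y : dist(x,y) ≤ 3} Σ_{μ,ν} √t(y,μ,ν)` with the plaquette defect
`t(y,μ,ν) = 3 − Re tr U_{y,μν} ≥ 0` (`re_trace_fundamentalRep_le_three`). We prove
`Σ_x V(U,x)² ≤ C · S_W(U)` with the absolute constant `C = 7⁴ · 16 · 7⁴ · 2`, where
`S_W = wilsonAction ρ₃ U = Σ_y Σ_{μ<ν} t(y,μ,ν)` is the tree's Wilson action
(`ρ₃ = fundamentalRep (Fin 3)`):

1. Cauchy–Schwarz three times (`sq_sum_le_card_mul_sum_sq`) and `(√t)² = t`: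
   `V(U,x)² ≤ #B(x,3) · 16 · Σ_{y ∈ B(x,3)} Σ_{μ,ν} t(y,μ,ν)` (`sq_sum_sum_sqrt_le`).
2. Ball counting `#B(x,3) ≤ 7⁴` on `(ℤ/Lℤ)⁴`, uniformly in `L` (each coordinate of `x − y` has
   cyclic absolute value `≤ 3`; `card_filter_cyclicAbs_le_le` of `LatticeToriProofs`).
3. Double counting with the symmetry of `torusDist`:
   `Σ_x Σ_{y ∈ B(x,3)} F(y) = Σ_y #B(y,3) F(y) ≤ 7⁴ Σ_y F(y)` for `F ≥ 0`.
   Steps 1–3 give `Σ_x V(U,x)² ≤ 7⁴ · 16 · 7⁴ · Σ_y Σ_μ Σ_ν t(y,μ,ν)` for ANY `t ≥ 0`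
   (`sum_sq_sitePotential_le`).
4. `Σ_y Σ_μ Σ_ν t(y,μ,ν) = 2 S_W(U)`: the diagonal terms vanish (`U_{y,μμ} = 1`) and
   `t(y,ν,μ) = t(y,μ,ν)` since `U_{y,νμ} = U_{y,μν}⁻¹ = U_{y,μν}^†` has the conjugate trace.
-/

namespace Summit.QuantumFields.QCD.Cruxes.ActionBoundsLowModes.DropTheWilsonSquare

open Literature.MathematicalPhysics Literature.MathematicalPhysics.QuantumLattice
  Literature.MathematicalPhysics.QuantumFieldTheory Literature.Probability.LatticeModels
open Matrix
open scoped Kronecker ComplexOrder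
open Summit.QuantumFields.QCD.Theorems.ActionBoundsLowModes.Negative
  (re_trace_fundamentalRep_le_three)

/-! ### Step 1: Cauchy–Schwarz over the `16 · #s` terms -/

/-- Cauchy–Schwarz three times: `(Σ_{y∈s} Σ_μ Σ_ν √f)² ≤ #s · 16 · Σ_{y∈s} Σ_μ Σ_ν f`
for `f ≥ 0`. -/
private theorem sq_sum_sum_sqrt_le {ι : Type*} (s : Finset ι) (f : ι → Fin 4 → Fin 4 → ℝ)
    (hf : ∀ y μ ν, 0 ≤ f y μ ν) :
    (∑ y ∈ s, ∑ μ, ∑ ν, Real.sqrt (f y μ ν)) ^ 2 ≤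
      ((s.card : ℝ) * 16) * ∑ y ∈ s, ∑ μ, ∑ ν, f y μ ν := by
  have hν : ∀ y μ, (∑ ν, Real.sqrt (f y μ ν)) ^ 2 ≤ 4 * ∑ ν, f y μ ν := fun y μ =>
    calc (∑ ν, Real.sqrt (f y μ ν)) ^ 2
        ≤ ((Finset.univ : Finset (Fin 4)).card : ℝ) * ∑ ν, Real.sqrt (f y μ ν) ^ 2 :=
          sq_sum_le_card_mul_sum_sq
      _ = 4 * ∑ ν, f y μ ν := by
          rw [Finset.card_univ, Fintype.card_fin, Nat.cast_ofNat]
          exact congrArg (4 * ·) (Finset.sum_congr rfl fun ν _ => Real.sq_sqrt (hf y μ ν))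
  have hμ : ∀ y, (∑ μ, ∑ ν, Real.sqrt (f y μ ν)) ^ 2 ≤ 16 * ∑ μ, ∑ ν, f y μ ν := fun y =>
    calc (∑ μ, ∑ ν, Real.sqrt (f y μ ν)) ^ 2
        ≤ ((Finset.univ : Finset (Fin 4)).card : ℝ) * ∑ μ, (∑ ν, Real.sqrt (f y μ ν)) ^ 2 :=
          sq_sum_le_card_mul_sum_sq
      _ ≤ 4 * ∑ μ, 4 * ∑ ν, f y μ ν := by
          rw [Finset.card_univ, Fintype.card_fin, Nat.cast_ofNat]
          exact mul_le_mul_of_nonneg_left (Finset.sum_le_sum fun μ _ => hν y μ) (by norm_num)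
      _ = 16 * ∑ μ, ∑ ν, f y μ ν := by rw [← Finset.mul_sum]; ring
  calc (∑ y ∈ s, ∑ μ, ∑ ν, Real.sqrt (f y μ ν)) ^ 2
      ≤ (s.card : ℝ) * ∑ y ∈ s, (∑ μ, ∑ ν, Real.sqrt (f y μ ν)) ^ 2 := sq_sum_le_card_mul_sum_sq
    _ ≤ (s.card : ℝ) * ∑ y ∈ s, 16 * ∑ μ, ∑ ν, f y μ ν :=
        mul_le_mul_of_nonneg_left (Finset.sum_le_sum fun y _ => hμ y) (Nat.cast_nonneg _)
    _ = ((s.card : ℝ) * 16) * ∑ y ∈ s, ∑ μ, ∑ ν, f y μ ν := by rw [← Finset.mul_sum]; ring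

/-! ### Step 2: ball counting on `(ℤ/Lℤ)⁴` -/

/-- Ball counting on `(ℤ/Lℤ)⁴`: `#{y | dist(x,y) ≤ r} ≤ (2r+1)⁴`, uniformly in `L` (each coordinate
of `x − y` has cyclic absolute value `≤ r`, at most `2r + 1` values each). -/
private theorem card_filter_torusDist_le_pow_four (L : ℕ) [NeZero L] (x : TorusSite 4 L) (r : ℕ) :
    (Finset.univ.filter fun y : TorusSite 4 L => torusDist x y ≤ r).card ≤ (2 * r + 1) ^ 4 := by
  -- adapted from `card_filter_torusDist_le_le`
  -- (Literature/MathematicalPhysics/QuantumLattice/StabilityTorusGeometryProofs)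
  classical
  set B : Finset (ZMod L) := Finset.univ.filter fun z : ZMod L => min z.val (L - z.val) ≤ r with hB
  have hBc : B.card ≤ 2 * r + 1 := card_filter_cyclicAbs_le_le r
  have hsub : ∀ y ∈ (Finset.univ.filter fun y : TorusSite 4 L => torusDist x y ≤ r),
      (x - y) ∈ Fintype.piFinset (fun _ : Fin 4 => B) := by
    intro y hy
    simp only [Finset.mem_filter, Finset.mem_univ, true_and] at hy
    unfold torusDist at hy
    simp only [torusNorm] at hy
    rw [Fintype.mem_piFinset]
    intro i
    simp only [hB, Finset.mem_filter, Finset.mem_univ, true_and]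
    exact (Finset.le_sup (f := fun i => min ((x - y) i).val (L - ((x - y) i).val))
      (Finset.mem_univ i)).trans hy
  calc (Finset.univ.filter fun y : TorusSite 4 L => torusDist x y ≤ r).card
      ≤ (Fintype.piFinset (fun _ : Fin 4 => B)).card := by
        refine Finset.card_le_card_of_injOn (fun y => x - y) hsub ?_
        intro u _ v _ h
        simpa using h
    _ = ∏ _i : Fin 4, B.card := Fintype.card_piFinset _
    _ ≤ ∏ _i : Fin 4, (2 * r + 1) := Finset.prod_le_prod' fun _ _ => hBc
    _ = (2 * r + 1) ^ 4 := by rw [Finset.prod_const, Finset.card_univ, Fintype.card_fin]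

/-! ### Step 3: double counting -/

/-- Double counting against the ball bound and the symmetry of `torusDist`:
`Σ_x Σ_{y : dist(x,y) ≤ 3} F(y) = Σ_y #{x | dist(y,x) ≤ 3} · F(y) ≤ 7⁴ Σ_y F(y)` for `F ≥ 0`. -/
private theorem sum_sum_ball_three_le (L : ℕ) [NeZero L] (F : TorusSite 4 L → ℝ)
    (hF : ∀ y, 0 ≤ F y) :
    ∑ x : TorusSite 4 L,
        ∑ y ∈ Finset.univ.filter (fun y : TorusSite 4 L => torusDist x y ≤ 3), F y ≤
      2401 * ∑ y : TorusSite 4 L, F y := by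
  calc ∑ x : TorusSite 4 L,
          ∑ y ∈ Finset.univ.filter (fun y : TorusSite 4 L => torusDist x y ≤ 3), F y
      = ∑ x : TorusSite 4 L, ∑ y : TorusSite 4 L, (if torusDist x y ≤ 3 then F y else 0) :=
        Finset.sum_congr rfl fun x _ => Finset.sum_filter _ _
    _ = ∑ y : TorusSite 4 L, ∑ x : TorusSite 4 L, (if torusDist x y ≤ 3 then F y else 0) :=
        Finset.sum_comm
    _ = ∑ y : TorusSite 4 L,
          ((Finset.univ.filter fun x : TorusSite 4 L => torusDist y x ≤ 3).card : ℝ) * F y := by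
        refine Finset.sum_congr rfl fun y _ => ?_
        rw [← Finset.sum_filter, Finset.sum_const, nsmul_eq_mul]
        congr 2
        exact congrArg Finset.card (Finset.filter_congr fun x _ => by rw [torusDist_comm'])
    _ ≤ ∑ y : TorusSite 4 L, 2401 * F y := by
        refine Finset.sum_le_sum fun y _ => mul_le_mul_of_nonneg_right ?_ (hF y)
        have h := card_filter_torusDist_le_pow_four L y 3
        norm_num at h
        exact_mod_cast h
    _ = 2401 * ∑ y : TorusSite 4 L, F y := (Finset.mul_sum _ _ _).symm

/-- Steps 1–3 combined: for every `t ≥ 0` on sites and ordered pairs of directions,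
`Σ_x (Σ_{y : dist(x,y) ≤ 3} Σ_μ Σ_ν √t(y,μ,ν))² ≤ 7⁴ · 16 · 7⁴ · Σ_y Σ_μ Σ_ν t(y,μ,ν)`. -/
private theorem sum_sq_sitePotential_le (L : ℕ) [NeZero L]
    (t : TorusSite 4 L → Fin 4 → Fin 4 → ℝ) (ht : ∀ y μ ν, 0 ≤ t y μ ν) :
    ∑ x : TorusSite 4 L,
        (∑ y ∈ Finset.univ.filter (fun y : TorusSite 4 L => torusDist x y ≤ 3),
          ∑ μ : Fin 4, ∑ ν : Fin 4, Real.sqrt (t y μ ν)) ^ 2 ≤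
      (2401 * 16 * 2401) * ∑ y : TorusSite 4 L, ∑ μ : Fin 4, ∑ ν : Fin 4, t y μ ν := by
  have hF0 : ∀ y : TorusSite 4 L, 0 ≤ ∑ μ : Fin 4, ∑ ν : Fin 4, t y μ ν := fun y =>
    Finset.sum_nonneg fun μ _ => Finset.sum_nonneg fun ν _ => ht y μ ν
  calc ∑ x : TorusSite 4 L,
          (∑ y ∈ Finset.univ.filter (fun y : TorusSite 4 L => torusDist x y ≤ 3),
            ∑ μ : Fin 4, ∑ ν : Fin 4, Real.sqrt (t y μ ν)) ^ 2
      ≤ ∑ x : TorusSite 4 L,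
          (((Finset.univ.filter (fun y : TorusSite 4 L => torusDist x y ≤ 3)).card : ℝ) * 16) *
            ∑ y ∈ Finset.univ.filter (fun y : TorusSite 4 L => torusDist x y ≤ 3),
              ∑ μ : Fin 4, ∑ ν : Fin 4, t y μ ν :=
        Finset.sum_le_sum fun x _ => sq_sum_sum_sqrt_le _ t ht
    _ ≤ ∑ x : TorusSite 4 L, (2401 * 16 : ℝ) *
            ∑ y ∈ Finset.univ.filter (fun y : TorusSite 4 L => torusDist x y ≤ 3),
              ∑ μ : Fin 4, ∑ ν : Fin 4, t y μ ν := by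
        refine Finset.sum_le_sum fun x _ => mul_le_mul_of_nonneg_right ?_
          (Finset.sum_nonneg fun y _ => hF0 y)
        have h := card_filter_torusDist_le_pow_four L x 3
        norm_num at h
        have h' : ((Finset.univ.filter (fun y : TorusSite 4 L => torusDist x y ≤ 3)).card : ℝ) ≤
            2401 := by exact_mod_cast h
        linarith
    _ = (2401 * 16 : ℝ) * ∑ x : TorusSite 4 L,
            ∑ y ∈ Finset.univ.filter (fun y : TorusSite 4 L => torusDist x y ≤ 3),
              ∑ μ : Fin 4, ∑ ν : Fin 4, t y μ ν :=
        (Finset.mul_sum _ _ _).symm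
    _ ≤ (2401 * 16 : ℝ) * (2401 * ∑ y : TorusSite 4 L, ∑ μ : Fin 4, ∑ ν : Fin 4, t y μ ν) :=
        mul_le_mul_of_nonneg_left (sum_sum_ball_three_le L _ hF0) (by norm_num)
    _ = (2401 * 16 * 2401) * ∑ y : TorusSite 4 L, ∑ μ : Fin 4, ∑ ν : Fin 4, t y μ ν := by ring

/-! ### Step 4: the sum over ordered pairs of directions is twice the Wilson action -/

/-- The degenerate plaquette holonomy is trivial: `U_{x,μμ} = 1`. -/
private theorem plaquetteHolonomy_self_eq_one {L : ℕ}
    (U : GaugeConfig 4 L ↥(Matrix.specialUnitaryGroup (Fin 3) ℂ)) (x : TorusSite 4 L) (μ : Fin 4) :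
    plaquetteHolonomy U x μ μ = 1 := by
  simp [plaquetteHolonomy]

/-- Reversing the orientation inverts the plaquette holonomy: `U_{x,νμ} = U_{x,μν}⁻¹`. -/
private theorem plaquetteHolonomy_swap_eq_inv {L : ℕ}
    (U : GaugeConfig 4 L ↥(Matrix.specialUnitaryGroup (Fin 3) ℂ)) (x : TorusSite 4 L)
    (μ ν : Fin 4) : plaquetteHolonomy U x ν μ = (plaquetteHolonomy U x μ ν)⁻¹ := by
  unfold plaquetteHolonomy
  group

/-- `Re tr g⁻¹ = Re tr g` on `SU(3)` (`g⁻¹ = g^†` has the conjugate trace). -/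
private theorem re_trace_fundamentalRep_inv (g : ↥(Matrix.specialUnitaryGroup (Fin 3) ℂ)) :
    ((fundamentalRep (Fin 3)) g⁻¹).trace.re = ((fundamentalRep (Fin 3)) g).trace.re := by
  rw [← star_rep_eq_rep_inv (fundamentalRep (Fin 3)) fundamentalRep_mem_unitaryGroup g,
    Matrix.star_eq_conjTranspose, Matrix.trace_conjTranspose, Complex.star_def, Complex.conj_re]

/-- A symmetric function on `Fin d × Fin d` vanishing on the diagonal: its full double sum is twice
its sum over the pairs `i < j`. -/
private theorem sum_sum_eq_two_mul_sum_lt {d : ℕ} (f : Fin d → Fin d → ℝ)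
    (hsymm : ∀ i j, f i j = f j i) (hdiag : ∀ i, f i i = 0) :
    ∑ i, ∑ j, f i j = 2 * ∑ q : {q : Fin d × Fin d // q.1 < q.2}, f q.1.1 q.1.2 := by
  -- adapted from `StaticPotential.sum_lt_eq_half_sum`
  -- (Literature/MathematicalPhysics/QuantumFieldTheory/LatticeGaugeStaticPotentialProofs)
  have hsplit : ∑ i, ∑ j, f i j =
      ∑ i, ∑ j, ((if i < j then f i j else 0) + (if j < i then f i j else 0)) := by
    refine Finset.sum_congr rfl fun i _ => Finset.sum_congr rfl fun j _ => ?_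
    rcases lt_trichotomy i j with h | rfl | h
    · simp [h, not_lt.2 h.le]
    · simp [hdiag]
    · simp [h, not_lt.2 h.le]
  have h1 : ∑ i, ∑ j, (if i < j then f i j else 0) =
      ∑ q : {q : Fin d × Fin d // q.1 < q.2}, f q.1.1 q.1.2 := by
    rw [← Finset.sum_product' (s := Finset.univ) (t := Finset.univ)
      (f := fun i j => if i < j then f i j else 0), Finset.univ_product_univ, ← Finset.sum_filter]
    exact Finset.sum_subtype _ (fun q => by simp) fun q : Fin d × Fin d => f q.1 q.2
  have h2 : ∑ i, ∑ j, (if j < i then f i j else 0) = ∑ i, ∑ j, (if i < j then f i j else 0) := by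
    rw [Finset.sum_comm]
    refine Finset.sum_congr rfl fun i _ => Finset.sum_congr rfl fun j _ => ?_
    split_ifs
    · exact hsymm _ _
    · rfl
  rw [hsplit, Finset.sum_congr rfl fun i _ => Finset.sum_add_distrib, Finset.sum_add_distrib, h2,
    h1]
  ring

/-- The plaquette defect `t(y,μ,ν) = 3 − Re tr U_{y,μν}` summed over all sites and all ORDERED
pairs of directions is twice the Wilson action `Σ_y Σ_{μ<ν} t(y,μ,ν)`. -/
private theorem sum_orderedPairs_eq_two_mul_wilsonAction (L : ℕ) [NeZero L]
    (U : GaugeConfig 4 L ↥(Matrix.specialUnitaryGroup (Fin 3) ℂ)) :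
    ∑ y : TorusSite 4 L, ∑ μ : Fin 4, ∑ ν : Fin 4,
        (3 - ((fundamentalRep (Fin 3)) (plaquetteHolonomy U y μ ν)).trace.re) =
      2 * wilsonAction (fundamentalRep (Fin 3)) U := by
  have hy : ∀ y : TorusSite 4 L, ∑ μ : Fin 4, ∑ ν : Fin 4,
      (3 - ((fundamentalRep (Fin 3)) (plaquetteHolonomy U y μ ν)).trace.re) =
        2 * ∑ q : {q : Fin 4 × Fin 4 // q.1 < q.2},
          (3 - ((fundamentalRep (Fin 3)) (plaquetteHolonomy U y q.1.1 q.1.2)).trace.re) := by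
    intro y
    refine sum_sum_eq_two_mul_sum_lt
      (fun μ ν => 3 - ((fundamentalRep (Fin 3)) (plaquetteHolonomy U y μ ν)).trace.re)
      (fun μ ν => ?_) (fun μ => ?_)
    · show (3 : ℝ) - _ = 3 - _
      rw [plaquetteHolonomy_swap_eq_inv U y μ ν, re_trace_fundamentalRep_inv]
    · show (3 : ℝ) - _ = 0
      rw [plaquetteHolonomy_self_eq_one, map_one, Matrix.trace_one, Fintype.card_fin]
      norm_num
  rw [Finset.sum_congr rfl fun y _ => hy y, ← Finset.mul_sum]
  unfold wilsonAction
  rw [Fintype.sum_prod_type]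
  push_cast
  rfl

/-! ### The stub -/

/-- **Stub B (`stub_curvSqLeAction`).**  `Σ_x V(U,x)² ≤ C · S_W(U)` with an absolute `C`:
Cauchy–Schwarz over the `≤ 16·7⁴` terms of `V(U,x)`, `(√t)² = t` for `t = 3 − Re tr U_□ ≥ 0`
(`re_trace_fundamentalRep_le_three`), double counting `Σ_x Σ_{dist(x,y)≤3} f(y) ≤ 7⁴ Σ_y f(y)`
(`torusDist` is symmetric), and `Σ_y Σ_{μ,ν} (3 − Re tr U_{y,μν}) = 2 · wilsonAction`
(`U_{y,νμ} = U_{y,μν}⁻¹`, `U_{y,μμ} = 1`). -/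
theorem stub_curvSqLeAction :
    ∃ C : ℝ, ∀ (L : ℕ) [NeZero L] (U : GaugeConfig 4 L ↥(Matrix.specialUnitaryGroup (Fin 3) ℂ)),
      ∑ x : TorusSite 4 L,
          (∑ y ∈ Finset.univ.filter (fun y : TorusSite 4 L => torusDist x y ≤ 3),
              ∑ μ : Fin 4, ∑ ν : Fin 4,
                Real.sqrt (3 - ((fundamentalRep (Fin 3)) (plaquetteHolonomy U y μ ν)).trace.re)) ^ 2 ≤
        C * wilsonAction (fundamentalRep (Fin 3)) U := by
  refine ⟨2401 * 16 * 2401 * 2, fun L _ U => ?_⟩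
  calc ∑ x : TorusSite 4 L,
          (∑ y ∈ Finset.univ.filter (fun y : TorusSite 4 L => torusDist x y ≤ 3),
              ∑ μ : Fin 4, ∑ ν : Fin 4,
                Real.sqrt (3 - ((fundamentalRep (Fin 3)) (plaquetteHolonomy U y μ ν)).trace.re)) ^ 2
      ≤ (2401 * 16 * 2401) * ∑ y : TorusSite 4 L, ∑ μ : Fin 4, ∑ ν : Fin 4,
          (3 - ((fundamentalRep (Fin 3)) (plaquetteHolonomy U y μ ν)).trace.re) :=
        sum_sq_sitePotential_le L
          (fun y μ ν => 3 - ((fundamentalRep (Fin 3)) (plaquetteHolonomy U y μ ν)).trace.re)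
          fun y μ ν => sub_nonneg.2 (re_trace_fundamentalRep_le_three _)
    _ = 2401 * 16 * 2401 * 2 * wilsonAction (fundamentalRep (Fin 3)) U := by
        rw [sum_orderedPairs_eq_two_mul_wilsonAction]
        ring

end Summit.QuantumFields.QCD.Cruxes.ActionBoundsLowModes.DropTheWilsonSquare
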